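import Summits.QuantumFields.YangMills.Theorems.IsotropyFromPowerCountingTemperedCurvatureMomentsApproximantsTransfer
import Summits.QuantumFields.YangMills.Theorems.IsotropyFromPowerCountingTemperedCurvatureMomentsShieldedSubseqTame
import Summits.QuantumFields.YangMills.Theorems.TemperedCurvatureMoments.Negative.EventuallyTameSector

/-!
# `TemperedCurvatureMoments` (T, stmt-QuantumFields-17721): T on the FREQUENTLY-tame sector; T ⟺ T on the EVENTUALLY-wild sector

Support file of the line `Sketch` of crux T (lead c1, reshape 2), corollaries of the landed stub A4
`stub_approximantsTransfer` (scheme-independence of T's conclusion `TemperedApproximants`):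

* `temperedApproximants_iff_of_admissible` — for two admissible spacing/box pairs the conclusion of T is the SAME
  proposition up to equivalence: T is a property of the limit `S₁|⁰𝒮` (order-zero temperedness), the data `(sch.a, sch.L)`
  in T are idle;
* `temperedApproximants_of_subseq` — approximants along a subsequence `(a ∘ φ, L ∘ φ)` of admissible data give
  approximants along `(a, L)`;
* `temperedApproximants_of_frequently_tame` — **T on the frequently-tame sector**: tie + `∃ B, ∃ᶠ k, β_k = 0 ∨ |c_k| ≤ B`
  ⇒ `TemperedApproximants sch.a sch.L S₁ n` for every `n > 0` (extract the tame subsequence; the reindexed scheme is tied,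
  `tie_reindex`, and eventually tame, so the disprover's `temperedApproximants_of_eventually_tame` (p144864) applies to it;
  transfer back by A4).  This closes the standing disprover's near-miss 1 (`Cruxes/TemperedCurvatureMoments/Disproof.lean` §5);
* `eventually_wild_of_not_temperedApproximants` — contrapositive: an obstruction to T at a tied scheme forces `β_k ≠ 0`
  EVENTUALLY and `|c_k| → ∞`;
* `temperedCurvatureMoments_iff_eventuallyWildSector` — **T is equivalent to its restriction to the eventually-wild
  sector** (non-zero coupling for all large `k` and divergent multiplicative renormalisation of the curvature species — the
  weak-coupling continuum limit `c_k ≍ a_k⁻⁴` and hypothetical finite-`β` critical points), sharpening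
  `temperedCurvatureMoments_iff_wildSector` (p144864: wild FREQUENTLY).

References: Osterwalder–Schrader 1973 §2, 1975 §2; Glimm–Jaffe 1987 §9.5–9.6. [folklore]
-/

noncomputable section

namespace Summit.QuantumFields.YangMills.Theorems.TemperedCurvatureMoments.Sketch

open scoped BigOperators
open MeasureTheory Filter Topology
open Literature.MathematicalPhysics.QuantumFieldTheory Literature.MathematicalPhysics.QuantumLattice
open Literature.MathematicalPhysics.AQFT
open Literature.Probability.LatticeModels (box Site)
open Summit.QuantumFields.YangMills.Theorems.CurvatureBoostCovariance.Negative (Tie W1 EightFrameRP PlanarCone)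
open Summit.QuantumFields.YangMills.Theorems.NPointIsotropy.Negative (E4)
open Summit.QuantumFields.YangMills.Theses.IsotropyFromPowerCounting (TemperedCurvatureMoments)
open Summit.QuantumFields.YangMills.Theorems.TemperedCurvatureMoments.Negative
  (TemperedApproximants temperedCurvatureMoments_iff temperedApproximants_of_eventually_tame)

/-- **The conclusion of T does not depend on the admissible spacing/box data**: for two admissible pairs `(a, L)`,
`(a', L')` (`a_k > 0`, `a_k → 0`, `a_k L_k → ∞`), `TemperedApproximants a L S₁ n ↔ TemperedApproximants a' L' S₁ n`
(`n > 0`).  T is a property of `S₁|⁰𝒮`. [folklore] -/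
theorem temperedApproximants_iff_of_admissible {n : ℕ} (hn : 0 < n) (S₁ : SchwingerFamily E4) {a a' : ℕ → ℝ}
    {L L' : ℕ → ℕ} (ha : ∀ k, 0 < a k) (ha0 : Tendsto a atTop (𝓝 0)) (haL : Tendsto (fun k => a k * L k) atTop atTop)
    (ha' : ∀ k, 0 < a' k) (ha0' : Tendsto a' atTop (𝓝 0)) (haL' : Tendsto (fun k => a' k * L' k) atTop atTop) :
    TemperedApproximants a L S₁ n ↔ TemperedApproximants a' L' S₁ n :=
  ⟨stub_approximantsTransfer n hn S₁ a' a L' L ha' ha0' haL' ha ha0 haL,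
    stub_approximantsTransfer n hn S₁ a a' L L' ha ha0 haL ha' ha0' haL'⟩

/-- **Approximants along a subsequence suffice**: for admissible `(a, L)` and a strictly monotone `φ`, tempered tied
approximants along `(a ∘ φ, L ∘ φ)` give tempered tied approximants along `(a, L)`. [folklore] -/
theorem temperedApproximants_of_subseq {n : ℕ} (hn : 0 < n) (S₁ : SchwingerFamily E4) {a : ℕ → ℝ} {L : ℕ → ℕ}
    (ha : ∀ k, 0 < a k) (ha0 : Tendsto a atTop (𝓝 0)) (haL : Tendsto (fun k => a k * L k) atTop atTop)
    {φ : ℕ → ℕ} (hφ : StrictMono φ) (h : TemperedApproximants (a ∘ φ) (L ∘ φ) S₁ n) :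
    TemperedApproximants a L S₁ n :=
  stub_approximantsTransfer n hn S₁ a (a ∘ φ) L (L ∘ φ) ha ha0 haL (fun k => ha (φ k)) (ha0.comp hφ.tendsto_atTop)
    (haL.comp hφ.tendsto_atTop) h

variable {G : Type} [Group G] [TopologicalSpace G] [IsTopologicalGroup G] [CompactSpace G]
  [MeasurableSpace G] [BorelSpace G]

/-- **T ON THE FREQUENTLY-TAME SECTOR** (the standing disprover's near-miss 1, closed).  If `S₁` is tied to the scheme
and, for some `B`, FREQUENTLY `β_k = 0 ∨ |c_k| ≤ B`, then the degree-`n` conclusion of T holds at `(sch.a, sch.L, S₁)` for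
every `n > 0`: along the tame subsequence `φ` the reindexed scheme `sch ∘ φ` is tied (`tie_reindex`) and EVENTUALLY (indeed
always) tame, so `temperedApproximants_of_eventually_tame` gives approximants along `(a ∘ φ, L ∘ φ)`, which transfer to
`(a, L)` (`temperedApproximants_of_subseq`, i.e. A4).  Only the tie is used. [folklore] -/
theorem temperedApproximants_of_frequently_tame (r : LatticeRep G) (sch : SpeciesScheme (YMSpecies G))
    (S₁ : SchwingerFamily E4) (htie : Tie r sch S₁)
    (h : ∃ B : ℝ, ∃ᶠ k in atTop, sch.β k = 0 ∨ |sch.c r.curvature k| ≤ B) {n : ℕ} (hn : 0 < n) :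
    TemperedApproximants sch.a sch.L S₁ n := by
  obtain ⟨B, hB⟩ := h
  obtain ⟨φ, hφ, hφB⟩ := extraction_of_frequently_atTop hB
  refine temperedApproximants_of_subseq hn S₁ sch.a_pos sch.tendsto_a sch.tendsto_L hφ ?_
  exact temperedApproximants_of_eventually_tame r
    { a := sch.a ∘ φ, a_pos := fun k => sch.a_pos (φ k), tendsto_a := sch.tendsto_a.comp hφ.tendsto_atTop,
      β := sch.β ∘ φ, L := sch.L ∘ φ, tendsto_L := sch.tendsto_L.comp hφ.tendsto_atTop,
      c := fun s => sch.c s ∘ φ, m := fun s => sch.m s ∘ φ } S₁ (tie_reindex r sch S₁ htie hφ)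
    ⟨B, Eventually.of_forall hφB⟩ hn

/-- **An obstruction to T forces the EVENTUALLY-wild regime**: if `S₁` is tied to the scheme and the degree-`n`
conclusion of T fails (`n > 0`), then `β_k ≠ 0` for all large `k` AND `|c_k| → ∞`. [folklore] -/
theorem eventually_wild_of_not_temperedApproximants (r : LatticeRep G) (sch : SpeciesScheme (YMSpecies G))
    (S₁ : SchwingerFamily E4) (htie : Tie r sch S₁) {n : ℕ} (hn : 0 < n)
    (h : ¬ TemperedApproximants sch.a sch.L S₁ n) :
    (∀ᶠ k in atTop, sch.β k ≠ 0) ∧ Tendsto (fun k => |sch.c r.curvature k|) atTop atTop := by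
  have key : ∀ B : ℝ, ∀ᶠ k in atTop, sch.β k ≠ 0 ∧ B < |sch.c r.curvature k| := by
    intro B
    by_contra hnot
    refine h (temperedApproximants_of_frequently_tame r sch S₁ htie ⟨B, ?_⟩ hn)
    rw [not_eventually] at hnot
    refine hnot.mono fun k hk => ?_
    by_cases hβ : sch.β k = 0
    · exact Or.inl hβ
    · exact Or.inr (not_lt.1 fun hlt => hk ⟨hβ, hlt⟩)
  exact ⟨(key 0).mono fun k hk => hk.1, tendsto_atTop.2 fun B => (key B).mono fun k hk => hk.2.le⟩

/-- **T is equivalent to its restriction to the EVENTUALLY-WILD sector** `(∀ᶠ k, β_k ≠ 0) ∧ |c_k| → ∞`: the only place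
a counterexample can live is a tied Wilson limit with non-zero coupling at all large steps and divergent multiplicative
renormalisation of `tr F²` — the weak-coupling continuum limit (`c_k ≍ a_k⁻⁴`) or a hypothetical finite-`β` critical point.
Sharpens `temperedCurvatureMoments_iff_wildSector` (p144864), where wildness was only frequent. [folklore] -/
theorem temperedCurvatureMoments_iff_eventuallyWildSector :
    TemperedCurvatureMoments ↔
      ∀ (G : Type) [Group G] [TopologicalSpace G] [IsTopologicalGroup G] [CompactSpace G]
        [MeasurableSpace G] [BorelSpace G], IsCompactSimpleLieGroup G →
        ∀ (r : LatticeRep G) (sch : SpeciesScheme (YMSpecies G)) (S₁ : SchwingerFamily E4),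
          W1 r sch S₁ → EightFrameRP S₁ → PlanarCone S₁ →
          (∀ᶠ k in atTop, sch.β k ≠ 0) → Tendsto (fun k => |sch.c r.curvature k|) atTop atTop →
          ∀ n : ℕ, 0 < n → TemperedApproximants sch.a sch.L S₁ n := by
  rw [temperedCurvatureMoments_iff]
  constructor
  · intro h G _ _ _ _ _ _ hG r sch S₁ hW h8 hC _ _ n hn
    exact h G hG r sch S₁ hW h8 hC n hn
  · intro h G _ _ _ _ _ _ hG r sch S₁ hW h8 hC n hn
    by_contra hT
    have hw := eventually_wild_of_not_temperedApproximants r sch S₁ hW.1 hn hT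
    exact hT (h G hG r sch S₁ hW h8 hC hw.1 hw.2 n hn)

end Summit.QuantumFields.YangMills.Theorems.TemperedCurvatureMoments.Sketch

end
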